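import Mathlib
import HarnessLib
import Summits.Ventures.LatticeQCDFlow.Exactness.IMHNaiveRetryBias

/-!
# LatticeQCDFlow / Exactness — STATE-DEPENDENT LAZINESS TILTS THE TARGET: skipping an exact update with a probability that depends on the
# current configuration samples `π/p`, not `π` (exact for the tilted law; defect identity for `π`; two-point witness)

HONEST FRAMING: exact (Metropolis-corrected) sampling algorithms for lattice gauge theory;
figures of merit are autocorrelation/cost numbers at stated couplings and volumes; no
continuum-physics claim.

Venture `LatticeQCDFlow` (cell pub-lqcd), topic `Exactness`, FANOUT row 30 (lean-1 GEN-43; the laziness twin of `IMHRejectionFallbackBias` and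
the reason behind the corrected ratios of `IMHStateDependentMoveChoice`).  NEW WORK of the cell; no definition is introduced, nothing is cited as a
fact.  Tree inputs: `IMHKernel`, the `Bool` bookkeeping of `IMHNaiveRetryBias` (`NaiveRetryWitness.*`).  Printed counterpart NAMED ONLY: the
invariant law of a chain slowed down by a state-dependent holding probability is the time-changed (tilted) law — classical (e.g. the embedded
∕ "speed-measure" picture of continuous-time chains); in adaptive-MCMC language, a state-dependent update schedule is a state-dependent mixture
of kernels (Roberts–Rosenthal 2007).

## Setting (general measurable `Ω`; `π` a finite measure; `P` ANY Markov kernel leaving `π` invariant — a flow-sampler step, an HMC trajectory;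
## `p : Ω → (0, 1]` measurable: the probability of ATTEMPTING the update from `x`)

THE LAZY SCHEDULE, def-free: ANY kernel `K` with `K(x, B) = p(x)·P(x, B) + (1 − p(x))·1_B(x)` — e.g. "attempt the (expensive) flow update
only with probability `p(x)` read off the current configuration, else keep it".

## Results [all ours]

* `stateLazy_apply_univ` ∕ `stateLazy_isMarkovKernel`.
* **`lazy_tilt_invariant` (WHAT IT SAMPLES)**: the TILTED law `π̃ = p⁻¹·π` is invariant under `K` — the lazy schedule is an exact sampler
  for `π/p` (normalised), whatever the exact kernel `P`: configurations from which the update is rarely attempted are over-weighted by `1/p`.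
  Remedies: reweight the run by `p`, or put `p(y)/p(x)` into the acceptance ratio (`IMHStateDependentMoveChoice`).
* **`lazy_bind_apply_add` (DEFECT FOR `π`)**: `(πK)(B) + (p·π)(B) = π(B) + ((p·π)P)(B)` — `π` itself is invariant iff `P` preserves the
  attempt-weighted measure `p·π`; in particular a CONSTANT `p` is harmless (`lazy_invariant_of_const`).
* **`lazy_not_invariant` (WITNESS)**: `Ω = Bool`, `P` = the exact flow sampler with `q` uniform and `w = (1, 2)`, attempt probabilities
  `p(false) = 1/2`, `p(true) = 1`: `(πK)({false}) = 5/8 ≠ 1/2 = π({false})`.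
-/

namespace Summit.Ventures.LatticeQCDFlow.Exactness

open MeasureTheory ProbabilityTheory
open scoped ENNReal

variable {Ω : Type*} [MeasurableSpace Ω] {π : Measure Ω} {p : Ω → ℝ≥0∞}

/-! ## §1 The lazy kernel -/

/-- `K(x, Ω) = p(x) + (1 − p(x)) = 1` for `p ≤ 1`. [ours] -/
theorem stateLazy_apply_univ (hp1 : ∀ x, p x ≤ 1) (P : Kernel Ω Ω) [IsMarkovKernel P] (K : Kernel Ω Ω)
    (hK : ∀ (x : Ω) {B : Set Ω}, MeasurableSet B → K x B = p x * P x B + (1 - p x) * B.indicator 1 x) (x : Ω) :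
    K x Set.univ = 1 := by
  rw [hK x MeasurableSet.univ, measure_univ, mul_one, Set.indicator_univ, Pi.one_apply, mul_one, add_tsub_cancel_of_le (hp1 x)]

/-- Hence `K` is Markov. [ours, bookkeeping] -/
theorem stateLazy_isMarkovKernel (hp1 : ∀ x, p x ≤ 1) (P : Kernel Ω Ω) [IsMarkovKernel P] (K : Kernel Ω Ω)
    (hK : ∀ (x : Ω) {B : Set Ω}, MeasurableSet B → K x B = p x * P x B + (1 - p x) * B.indicator 1 x) : IsMarkovKernel K :=
  ⟨fun x => ⟨stateLazy_apply_univ hp1 P K hK x⟩⟩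

/-- **`(μK)(B) = ∫ p(x)P(x, B) dμ + ∫_B (1 − p) dμ`** for every measure `μ`. [ours] -/
theorem lazy_bind_apply (hp : Measurable p) (P : Kernel Ω Ω) (K : Kernel Ω Ω)
    (hK : ∀ (x : Ω) {B : Set Ω}, MeasurableSet B → K x B = p x * P x B + (1 - p x) * B.indicator 1 x) (μ : Measure Ω)
    {B : Set Ω} (hB : MeasurableSet B) :
    (μ.bind K) B = ∫⁻ x, p x * P x B ∂μ + ∫⁻ x in B, (1 - p x) ∂μ := by
  have hm1 : Measurable fun x => p x * P x B := hp.mul (Kernel.measurable_coe P hB)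
  rw [Measure.bind_apply hB (Kernel.aemeasurable _)]
  simp_rw [hK _ hB]
  rw [lintegral_add_left hm1, ← lintegral_indicator hB]
  congr 1
  refine lintegral_congr fun x => ?_
  by_cases hx : x ∈ B
  · rw [Set.indicator_of_mem hx, Set.indicator_of_mem hx, Pi.one_apply, mul_one]
  · rw [Set.indicator_of_notMem hx, Set.indicator_of_notMem hx, mul_zero]

/-! ## §2 What the lazy schedule samples: the tilted law `π/p` -/

/-- **THE LAZY SCHEDULE IS EXACT FOR THE TILTED LAW `p⁻¹·π`**: for every `π`-invariant Markov `P`, every measurable `0 < p ≤ 1` and `π` finite with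
`p⁻¹·π` finite on `B`: `((p⁻¹·π)K)(B) = (p⁻¹·π)(B)`. [ours] -/
theorem lazy_tilt_bind_apply (hp : Measurable p) (hp0 : ∀ x, p x ≠ 0) (hp1 : ∀ x, p x ≤ 1) (P : Kernel Ω Ω) [IsMarkovKernel P]
    (hP : Kernel.Invariant P π) (K : Kernel Ω Ω)
    (hK : ∀ (x : Ω) {B : Set Ω}, MeasurableSet B → K x B = p x * P x B + (1 - p x) * B.indicator 1 x)
    {B : Set Ω} (hB : MeasurableSet B) (hfin : π B ≠ ⊤) :
    ((π.withDensity fun x => (p x)⁻¹).bind K) B = (π.withDensity fun x => (p x)⁻¹) B := by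
  have hpi : Measurable fun x => (p x)⁻¹ := hp.inv
  have hpt : ∀ x, p x ≠ ⊤ := fun x => ne_top_of_le_ne_top ENNReal.one_ne_top (hp1 x)
  have hPB : Measurable fun x => P x B := Kernel.measurable_coe P hB
  have hm1 : Measurable fun x => p x * P x B := hp.mul hPB
  have hsub : Measurable fun x => 1 - p x := measurable_const.sub hp
  have h1 : ∀ x, (p x)⁻¹ * (p x * P x B) = P x B := fun x => by
    rw [← mul_assoc, ENNReal.inv_mul_cancel (hp0 x) (hpt x), one_mul]
  have hinv : ∫⁻ x, P x B ∂π = π B := by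
    have := congrArg (fun μ : Measure Ω => μ B) hP.def
    simpa only [Measure.bind_apply hB (Kernel.aemeasurable _)] using this
  -- `(p⁻¹π)K(B) + π(B) = πP(B) + ∫_B p⁻¹(1 − p) dπ + π(B) = π(B) + (p⁻¹π)(B)`
  have key : ((π.withDensity fun x => (p x)⁻¹).bind K) B + π B = (π.withDensity fun x => (p x)⁻¹) B + π B := by
    rw [lazy_bind_apply hp P K hK _ hB, lintegral_withDensity_eq_lintegral_mul _ hpi hm1,
      setLIntegral_withDensity_eq_setLIntegral_mul _ hpi hsub hB, withDensity_apply _ hB]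
    simp only [Pi.mul_apply]
    simp_rw [h1]
    rw [hinv]
    congr 1
    rw [show π B = ∫⁻ _ in B, 1 ∂π by rw [setLIntegral_const, one_mul], ← lintegral_add_left measurable_const]
    refine lintegral_congr fun x => ?_
    rw [ENNReal.mul_sub (fun _ _ => ENNReal.inv_ne_top.2 (hp0 x)), mul_one, ENNReal.inv_mul_cancel (hp0 x) (hpt x),
      add_tsub_cancel_of_le (ENNReal.one_le_inv.2 (hp1 x))]
  exact (ENNReal.add_left_inj hfin).1 key

/-- **… AS INVARIANCE**: for `π` finite, `p⁻¹·π` is invariant under the lazy schedule. [ours] -/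
theorem lazy_tilt_invariant [IsFiniteMeasure π] (hp : Measurable p) (hp0 : ∀ x, p x ≠ 0) (hp1 : ∀ x, p x ≤ 1) (P : Kernel Ω Ω)
    [IsMarkovKernel P] (hP : Kernel.Invariant P π) (K : Kernel Ω Ω)
    (hK : ∀ (x : Ω) {B : Set Ω}, MeasurableSet B → K x B = p x * P x B + (1 - p x) * B.indicator 1 x) :
    Kernel.Invariant K (π.withDensity fun x => (p x)⁻¹) := by
  show (π.withDensity fun x => (p x)⁻¹).bind K = _
  ext B hB
  exact lazy_tilt_bind_apply hp hp0 hp1 P hP K hK hB (measure_ne_top π B)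

/-! ## §3 The defect for `π` itself -/

/-- **THE DEFECT IDENTITY FOR `π`**: `(πK)(B) + (p·π)(B) = π(B) + ((p·π)P)(B)` — the lazy schedule keeps `π` iff `P` preserves the
attempt-weighted measure `p·π`. [ours] -/
theorem lazy_bind_apply_add (hp : Measurable p) (hp1 : ∀ x, p x ≤ 1) (P : Kernel Ω Ω) (K : Kernel Ω Ω)
    (hK : ∀ (x : Ω) {B : Set Ω}, MeasurableSet B → K x B = p x * P x B + (1 - p x) * B.indicator 1 x)
    {B : Set Ω} (hB : MeasurableSet B) :
    (π.bind K) B + (π.withDensity p) B = π B + ((π.withDensity p).bind P) B := by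
  have hPB : Measurable fun x => P x B := Kernel.measurable_coe P hB
  have hsub : Measurable fun x => 1 - p x := measurable_const.sub hp
  rw [lazy_bind_apply hp P K hK π hB, withDensity_apply _ hB, Measure.bind_apply hB (Kernel.aemeasurable _),
    lintegral_withDensity_eq_lintegral_mul _ hp hPB]
  simp only [Pi.mul_apply]
  rw [add_assoc, add_comm (∫⁻ x, p x * P x B ∂π), ← lintegral_add_left hsub]
  congr 1
  rw [show π B = ∫⁻ _ in B, 1 ∂π by rw [setLIntegral_const, one_mul]]
  exact lintegral_congr fun x => tsub_add_cancel_of_le (hp1 x)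

/-- **A CONSTANT ATTEMPT PROBABILITY IS HARMLESS**: `p ≡ c ∈ (0, 1]` ⇒ `(πK)(B) = π(B)` on sets of finite mass. [ours] -/
theorem lazy_bind_apply_eq_of_const {c : ℝ≥0∞} (hc1 : c ≤ 1) (P : Kernel Ω Ω) (hP : Kernel.Invariant P π) (K : Kernel Ω Ω)
    (hK : ∀ (x : Ω) {B : Set Ω}, MeasurableSet B → K x B = c * P x B + (1 - c) * B.indicator 1 x)
    {B : Set Ω} (hB : MeasurableSet B) (hfin : π B ≠ ⊤) : (π.bind K) B = π B := by
  have h := lazy_bind_apply_add (π := π) (p := fun _ => c) measurable_const (fun _ => hc1) P K hK hB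
  have hc : (π.withDensity fun _ => c) = c • π := by
    rw [show (fun _ : Ω => c) = c • (1 : Ω → ℝ≥0∞) from funext fun x => by simp, withDensity_smul _ measurable_one, withDensity_one]
  rw [hc, Measure.bind_smul, hP.def, Measure.smul_apply, smul_eq_mul] at h
  exact (ENNReal.add_left_inj (ENNReal.mul_ne_top (ne_top_of_le_ne_top ENNReal.one_ne_top hc1) hfin)).1 h

/-! ## §4 The two-point witness -/

section LazyWitness

variable {q : Measure Bool} {w : Bool → ℝ} {p : Bool → ℝ≥0∞}

/-- **THE WITNESS, QUANTIFIED**: `P` = the exact flow sampler on `Bool` (`q` uniform, `w = (1, 2)`), attempt probabilities `p(false) = 1/2`,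
`p(true) = 1`: one lazy step from `π` puts mass `5/8` on `false` (target `1/2`). [ours] -/
theorem lazy_bind_apply_false (hq : ∀ b, q {b} = ENNReal.ofReal 2⁻¹) (hwf : w false = 1) (hwt : w true = 2)
    (hpf : p false = ENNReal.ofReal 2⁻¹) (hpt : p true = 1) (P : Kernel Bool Bool)
    (hP : ∀ (x : Bool) {B : Set Bool}, MeasurableSet B → P x B =
      ∫⁻ y in B, imhAcceptE w x y ∂q + (1 - imhAcceptMass q w x) * B.indicator 1 x)
    (K : Kernel Bool Bool)
    (hK : ∀ (x : Bool) {B : Set Bool}, MeasurableSet B → K x B = p x * P x B + (1 - p x) * B.indicator 1 x) :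
    ((q.withDensity fun y => ENNReal.ofReal (w y)).bind K) {false} = ENNReal.ofReal (5 / 8) := by
  obtain ⟨hff, -, htf, -⟩ := NaiveRetryWitness.imhAcceptE_eq hwf hwt
  obtain ⟨hAf, hAt⟩ := NaiveRetryWitness.imhAcceptMass_eq hq hwf hwt
  obtain ⟨hπf, hπt⟩ := NaiveRetryWitness.target_eq hq hwf hwt
  have hPf : P false {false} = ENNReal.ofReal 2⁻¹ := by
    rw [hP false (measurableSet_singleton _), NaiveRetryWitness.setLIntegral_false_eq hq, hff, hAf, tsub_self, zero_mul, add_zero, one_mul]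
  have hPt : P true {false} = ENNReal.ofReal 4⁻¹ := by
    rw [hP true (measurableSet_singleton _), NaiveRetryWitness.setLIntegral_false_eq hq, htf,
      Set.indicator_of_notMem (by simp), mul_zero, add_zero, ← ENNReal.ofReal_mul (by norm_num)]
    norm_num
  have hKf : K false {false} = ENNReal.ofReal (3 / 4) := by
    rw [hK false (measurableSet_singleton _), hPf, hpf, Set.indicator_of_mem (Set.mem_singleton _), Pi.one_apply, mul_one,
      ← ENNReal.ofReal_one, ← ENNReal.ofReal_sub _ (by norm_num), ← ENNReal.ofReal_mul (by norm_num),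
      ← ENNReal.ofReal_add (by norm_num) (by norm_num)]
    norm_num
  have hKt : K true {false} = ENNReal.ofReal 4⁻¹ := by
    rw [hK true (measurableSet_singleton _), hPt, hpt, one_mul, tsub_self, zero_mul, add_zero]
  rw [Measure.bind_apply (measurableSet_singleton _) (Kernel.aemeasurable _), lintegral_fintype, Fintype.sum_bool,
    hKf, hKt, hπf, hπt, mul_one, ← ENNReal.ofReal_mul (by norm_num), ← ENNReal.ofReal_add (by norm_num) (by norm_num)]
  norm_num

/-- **STATE-DEPENDENT LAZINESS IS NOT EXACT**: with an exact flow step attempted with probability `1/2` from `false` and `1` from `true`,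
`π` is not invariant (two-point witness). [ours] -/
theorem lazy_not_invariant (hq : ∀ b, q {b} = ENNReal.ofReal 2⁻¹) (hwf : w false = 1) (hwt : w true = 2)
    (hpf : p false = ENNReal.ofReal 2⁻¹) (hpt : p true = 1) (P : Kernel Bool Bool)
    (hP : ∀ (x : Bool) {B : Set Bool}, MeasurableSet B → P x B =
      ∫⁻ y in B, imhAcceptE w x y ∂q + (1 - imhAcceptMass q w x) * B.indicator 1 x)
    (K : Kernel Bool Bool)
    (hK : ∀ (x : Bool) {B : Set Bool}, MeasurableSet B → K x B = p x * P x B + (1 - p x) * B.indicator 1 x) :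
    ¬ Kernel.Invariant K (q.withDensity fun y => ENNReal.ofReal (w y)) := by
  intro h
  have h1 := congrArg (fun μ : Measure Bool => μ {false}) h.def
  rw [lazy_bind_apply_false hq hwf hwt hpf hpt P hP K hK, (NaiveRetryWitness.target_eq hq hwf hwt).1,
    ENNReal.ofReal_eq_ofReal_iff (by norm_num) (by norm_num)] at h1
  norm_num at h1

end LazyWitness

end Summit.Ventures.LatticeQCDFlow.Exactness
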